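import Summits.QuantumFields.YangMills.Theorems.UnitScaleTiltProp7OffsetFamilyTransported
import Mathlib.Algebra.Order.Chebyshev
import HarnessLib

/-!
# Route `UnitScaleTilt`, crux K1 «MinimiserStabilityRegPr» (stmt-QuantumFields-19200), route-R E′ path (α′), S3 K-form engine, (H)-REDUCTION «hDir ⟸ hKg-K» — FILE 9r (brick T1):
# TRANSPORT TELESCOPING ALONG A WORD ON THE TORUS — `‖R(𝒱(x;w))·f(x + disp w) − f(x)‖ ≤ Σ_(k<|w|) ‖D_𝒱 f‖(k-th bond)` (forward letters give `D_𝒱`, backward letters give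
# LITERALLY `D*_𝒱` of ✓ `B9Eq39Adjoint.covDstar`), both orientations, the Cauchy–Schwarz square, and the RE-BASE step of ★p1 g16's (H)-REDUCTION (NAMER WORD 7 (2), 2026-08-28
# 23:49Z): `‖[R(T)P, m]‖ ≤ ‖[P, φ]‖ + 2‖P − 1‖·‖R(T⁻¹)m − φ‖` (the transported-plaquette letter of the (Kg′) family = a LOCAL plaquette commutator + small field × transport difference).

Cell `ym3-torus`, D-0154 (3c) twin-width seat `ym-routeR-w1` (gen 6); ★p1 g16 WORD 7 «routeR-w1: (H)-RED-1» (LOCATE routeR-w1 23:56Z: T1 = this file; T2 path-occupation count, T3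
assembly = later hands).  THEOREMS ONLY (0 `def`, 0 `sorry`); `--supports stmt-QuantumFields-19200`, count-neutral.  YM₃ on T³ is a ladder rung (R3), not the Clay problem; nothing
here claims a stub, the crux, d = 4 or the gap.

WHAT (ns `…Theorems.Prop7TransportTelescoping`; any torus `Site P j`, bi-contractive `V`).
* ★★ `norm_R_holT_sub_le` (T1): `‖R(holT V x w)(f(transl x (disp w))) − f x‖ ≤ Σ_(k : Fin |w|) [fwd: ‖covD … (w_k).1 f x_k‖ | bwd: ‖covDstar … (w_k).1 f x_k‖]`, `x_k = transl x (disp (w↾k))`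
  (induction on `w`; isometry ✓ `norm_R_eq`).
* ★ `norm_sub_R_holT_inv_le` (the model's orientation: `‖f(x + disp w) − R(holT V x w)⁻¹ f(x)‖ ≤` the same sum), ★ `norm_sub_R_holT_inv_sq_le` (`… ² ≤ |w|·Σ_k (…)²`, ✓ `sq_sum_le_card_mul_sum_sq`).
* ★ `comm_transported_le` (RE-BASE, normed ring): `‖R(T)P·m − m·R(T)P‖ ≤ ‖P·φ − φ·P‖ + 2‖P − 1‖·‖R(T⁻¹)m − φ‖` (✓ `comm_R_inv_eq` ∘ ✓ `comm_le_comm_add`).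
HONEST SCOPE.  Kinematics of the adjoint transport; no estimate of the series, no count (T2) and no booking (T3).

References: T. Bałaban, CMP 99 (1985) 389–434 [Balaban1985BackgroundPropagators] ((3.1) p.390, (3.3) p.390, (3.8) p.392); CMP 102 (1985) 255–275 [Balaban1985UV3] ((27) p.263).
-/

set_option autoImplicit false

noncomputable section

open scoped BigOperators

namespace Summit.QuantumFields.YangMills.Theorems.Prop7TransportTelescoping

open Literature.MathematicalPhysics.QuantumFieldTheory.Balaban1983to89
open B7Prop1Explicit (Letter e disp disp_cons disp_nil)
open B9Eq39Adjoint (R R_sub R_one R_inv_R covD covDstar)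
open B9TorusCalculus (torusT torusT_apply torusT_symm_apply)
open B10Eq27TorusAxialLog (holT transl transl_add transl_add_e transl_sub_e transl_zero holT_nil holT_cons_true holT_cons_false)
open Summit.QuantumFields.YangMills.Theorems.Prop7PinnedSupOfGradient (norm_R_eq)
open Summit.QuantumFields.YangMills.Theorems.Prop7CommutatorChain (comm_le_comm_add)
open Summit.QuantumFields.YangMills.Theorems.Prop7OffsetFamilyTransported (comm_R_inv_eq)

/-! ## §1 The re-base step -/

section Algebra

variable {𝔸 : Type*} [NormedRing 𝔸]

/-- ★ **RE-BASE**: `‖R(T)P·m − m·R(T)P‖ ≤ ‖P·φ − φ·P‖ + 2‖P − 1‖·‖R(T⁻¹)m − φ‖` for a bi-contractive transport `T`, any `φ` (the field at the plaquette's own site): the transported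
commutator is the local one plus small field × transport difference. [cite: Balaban1985BackgroundPropagators, (3.1) p.390] -/
theorem comm_transported_le {T : 𝔸ˣ} (hT : ‖(T : 𝔸)‖ ≤ 1 ∧ ‖((T⁻¹ : 𝔸ˣ) : 𝔸)‖ ≤ 1) (P m φ : 𝔸) :
    ‖R T P * m - m * R T P‖ ≤ ‖P * φ - φ * P‖ + 2 * ‖P - 1‖ * ‖R T⁻¹ m - φ‖ := by
  rw [← comm_R_inv_eq hT P m]
  exact comm_le_comm_add P (R T⁻¹ m) φ

end Algebra

/-! ## §2 Telescoping along a word -/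

section Torus

variable {𝔸 : Type*} [NormedRing 𝔸] [NormOneClass 𝔸] {P : Params} {j : ℕ} (V : GaugeField P j 𝔸ˣ)
  (hV : ∀ b : PBond P j, ‖(V b : 𝔸)‖ ≤ 1 ∧ ‖(((V b)⁻¹ : 𝔸ˣ) : 𝔸)‖ ≤ 1)

omit [NormOneClass 𝔸] in
/-- one forward step: `transl x (e_μ) = x + e_μ`. [folklore] -/
theorem transl_e (x : Site P j) (μ : Fin P.d) : transl x (e μ) = x.shift μ := by
  rw [← zero_add (e μ), transl_add_e, transl_zero]

omit [NormOneClass 𝔸] in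
/-- one backward step: `transl x (−e_μ) = x − e_μ`. [folklore] -/
theorem transl_neg_e (x : Site P j) (μ : Fin P.d) : transl x (-e μ) = x.unshift μ := by
  rw [← zero_sub (e μ), transl_sub_e, transl_zero]

include hV in
omit [NormOneClass 𝔸] in
/-- ★★ **TRANSPORT TELESCOPING (T1)**: `‖R(𝒱(x;w))·f(x + disp w) − f(x)‖ ≤ Σ_(k<|w|) ‖(D_𝒱 f)(k-th bond)‖`, the `k`-th term being `‖covD‖` at `x_k = x + disp(w↾k)` for a forward
letter and `‖covDstar‖` at `x_k` for a backward one. [cite: Balaban1985BackgroundPropagators, (3.1) p.390, (3.3) p.390, (3.8) p.392] -/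
theorem norm_R_holT_sub_le (f : Site P j → 𝔸) : ∀ (x : Site P j) (w : List (Letter P.d)),
    ‖R (holT V x w) (f (transl x (disp w))) - f x‖
      ≤ ∑ k : Fin w.length, (if (w.get k).2 then ‖covD (torusT P j) (fun κ z => V ⟨z, κ⟩) (w.get k).1 f (transl x (disp (w.take k)))‖
          else ‖covDstar (torusT P j) (fun κ z => V ⟨z, κ⟩) (w.get k).1 f (transl x (disp (w.take k)))‖)
  | x, [] => by simp [holT_nil, R_one]
  | x, (μ, true) :: w => by
    have ih := norm_R_holT_sub_le f (x.shift μ) w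
    have hb := hV ⟨x, μ⟩
    have step : ‖R (holT V x ((μ, true) :: w)) (f (transl x (disp ((μ, true) :: w)))) - f x‖
        ≤ ‖covD (torusT P j) (fun κ z => V ⟨z, κ⟩) μ f x‖
          + ∑ k : Fin w.length, (if (w.get k).2 then ‖covD (torusT P j) (fun κ z => V ⟨z, κ⟩) (w.get k).1 f (transl (x.shift μ) (disp (w.take k)))‖
              else ‖covDstar (torusT P j) (fun κ z => V ⟨z, κ⟩) (w.get k).1 f (transl (x.shift μ) (disp (w.take k)))‖) := by
      rw [holT_cons_true, B9Eq39Adjoint.R_mul, disp_cons, Letter.vec_true, transl_add, transl_e]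
      have e1 : R (V ⟨x, μ⟩) (R (holT V (x.shift μ) w) (f (transl (x.shift μ) (disp w)))) - f x
          = R (V ⟨x, μ⟩) (R (holT V (x.shift μ) w) (f (transl (x.shift μ) (disp w))) - f (x.shift μ)) + (R (V ⟨x, μ⟩) (f (x.shift μ)) - f x) := by
        rw [R_sub, sub_add_sub_cancel]
      rw [e1]
      refine (norm_add_le _ _).trans ?_
      rw [norm_R_eq hb.1 hb.2, add_comm, covD, torusT_apply]
      exact add_le_add le_rfl ih
    refine step.trans (le_of_eq ?_)
    simp only [Fin.sum_univ_succ, List.length_cons, List.get_eq_getElem, Fin.val_zero, List.getElem_cons_zero, List.take_zero, disp_nil,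
      transl_zero, Fin.val_succ, List.getElem_cons_succ, List.take_succ_cons, disp_cons, Letter.vec_true, transl_add, transl_e, if_true]
  | x, (μ, false) :: w => by
    have ih := norm_R_holT_sub_le f (x.unshift μ) w
    have hb : ‖(((V ⟨x.unshift μ, μ⟩)⁻¹ : 𝔸ˣ) : 𝔸)‖ ≤ 1 ∧ ‖((((V ⟨x.unshift μ, μ⟩)⁻¹)⁻¹ : 𝔸ˣ) : 𝔸)‖ ≤ 1 :=
      ⟨(hV _).2, by rw [inv_inv]; exact (hV _).1⟩
    have step : ‖R (holT V x ((μ, false) :: w)) (f (transl x (disp ((μ, false) :: w)))) - f x‖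
        ≤ ‖covDstar (torusT P j) (fun κ z => V ⟨z, κ⟩) μ f x‖
          + ∑ k : Fin w.length, (if (w.get k).2 then ‖covD (torusT P j) (fun κ z => V ⟨z, κ⟩) (w.get k).1 f (transl (x.unshift μ) (disp (w.take k)))‖
              else ‖covDstar (torusT P j) (fun κ z => V ⟨z, κ⟩) (w.get k).1 f (transl (x.unshift μ) (disp (w.take k)))‖) := by
      rw [holT_cons_false, B9Eq39Adjoint.R_mul, disp_cons, Letter.vec_false, transl_add, transl_neg_e]
      have e1 : R (V ⟨x.unshift μ, μ⟩)⁻¹ (R (holT V (x.unshift μ) w) (f (transl (x.unshift μ) (disp w)))) - f x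
          = R (V ⟨x.unshift μ, μ⟩)⁻¹ (R (holT V (x.unshift μ) w) (f (transl (x.unshift μ) (disp w))) - f (x.unshift μ))
            + (R (V ⟨x.unshift μ, μ⟩)⁻¹ (f (x.unshift μ)) - f x) := by
        rw [R_sub, sub_add_sub_cancel]
      rw [e1]
      refine (norm_add_le _ _).trans ?_
      rw [norm_R_eq hb.1 hb.2, add_comm, covDstar, torusT_symm_apply]
      exact add_le_add le_rfl ih
    refine step.trans (le_of_eq ?_)
    simp only [Fin.sum_univ_succ, List.length_cons, List.get_eq_getElem, Fin.val_zero, List.getElem_cons_zero, List.take_zero, disp_nil,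
      transl_zero, Fin.val_succ, List.getElem_cons_succ, List.take_succ_cons, disp_cons, Letter.vec_false, transl_add, transl_neg_e,
      Bool.false_eq_true, if_false]

include hV in
/-- ★ the local model's orientation: `‖f(x + disp w) − R(𝒱(x;w))⁻¹ f(x)‖ ≤` the same telescoping sum (isometry of `R`). [cite: Balaban1985BackgroundPropagators, (3.1) p.390] -/
theorem norm_sub_R_holT_inv_le (f : Site P j → 𝔸) (x : Site P j) (w : List (Letter P.d)) :
    ‖f (transl x (disp w)) - R (holT V x w)⁻¹ (f x)‖
      ≤ ∑ k : Fin w.length, (if (w.get k).2 then ‖covD (torusT P j) (fun κ z => V ⟨z, κ⟩) (w.get k).1 f (transl x (disp (w.take k)))‖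
          else ‖covDstar (torusT P j) (fun κ z => V ⟨z, κ⟩) (w.get k).1 f (transl x (disp (w.take k)))‖) := by
  have hT := Prop7AxialLocalModel.bicontr_holT V hV x w
  have hTi : ‖(((holT V x w)⁻¹ : 𝔸ˣ) : 𝔸)‖ ≤ 1 ∧ ‖((((holT V x w)⁻¹)⁻¹ : 𝔸ˣ) : 𝔸)‖ ≤ 1 := ⟨hT.2, by rw [inv_inv]; exact hT.1⟩
  have e : f (transl x (disp w)) - R (holT V x w)⁻¹ (f x) = R (holT V x w)⁻¹ (R (holT V x w) (f (transl x (disp w))) - f x) := by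
    rw [R_sub, R_inv_R]
  rw [e, norm_R_eq hTi.1 hTi.2]
  exact norm_R_holT_sub_le V hV f x w

include hV in
/-- ★ **THE SQUARE** (Cauchy–Schwarz): `‖f(x + disp w) − R(𝒱(x;w))⁻¹ f(x)‖² ≤ |w|·Σ_(k<|w|) ‖(D_𝒱 f)(k-th bond)‖²`. [cite: Balaban1985BackgroundPropagators, (3.1) p.390, (3.3) p.390] -/
theorem norm_sub_R_holT_inv_sq_le (f : Site P j → 𝔸) (x : Site P j) (w : List (Letter P.d)) :
    ‖f (transl x (disp w)) - R (holT V x w)⁻¹ (f x)‖ ^ 2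
      ≤ (w.length : ℝ) * ∑ k : Fin w.length, (if (w.get k).2 then ‖covD (torusT P j) (fun κ z => V ⟨z, κ⟩) (w.get k).1 f (transl x (disp (w.take k)))‖
          else ‖covDstar (torusT P j) (fun κ z => V ⟨z, κ⟩) (w.get k).1 f (transl x (disp (w.take k)))‖) ^ 2 := by
  have h := norm_sub_R_holT_inv_le V hV f x w
  refine (pow_le_pow_left₀ (norm_nonneg _) h 2).trans ?_
  have cs := sq_sum_le_card_mul_sum_sq (s := (Finset.univ : Finset (Fin w.length)))
    (f := fun k => (if (w.get k).2 then ‖covD (torusT P j) (fun κ z => V ⟨z, κ⟩) (w.get k).1 f (transl x (disp (w.take k)))‖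
          else ‖covDstar (torusT P j) (fun κ z => V ⟨z, κ⟩) (w.get k).1 f (transl x (disp (w.take k)))‖))
  rw [Finset.card_univ, Fintype.card_fin] at cs
  exact cs

end Torus

end Summit.QuantumFields.YangMills.Theorems.Prop7TransportTelescoping

end
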